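import Mathlib.Data.Fin.Tuple.Sort
import Literature.Combinatorics.Sahi2008.ProvedCases
import Summits.CriticalPhenomena.PercolationContinuityZ3.Theorems.PercNearOneGluingNoHeavyLowerTailSahiGridThreeCheckTwo
import Summits.CriticalPhenomena.PercolationContinuityZ3.Theorems.PercNearOneGluingNoHeavyLowerTailSahiWidthPhaseDiagram
import Summits.CriticalPhenomena.PercolationContinuityZ3.Theorems.SahiLiebSahiContinuum

/-!
# `NoHeavyLowerTail` (crux stmt-CriticalPhenomena-4575), Sahi programme P1: **SAHI'S `C₃` ON EVERY THREE-DIMENSIONAL GRID** —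
# the first open cell `(d,n) = (3,3)` of the width stratification (Lieb–Sahi's Conjecture 1.1 in dimension 3 at order 3)

Support file (Sahi cell, seat `prim-sahi-p1`, generation 6; `--supports stmt-CriticalPhenomena-4575`).  Pure proofs, no definitions of
substance, no `sorry`; rests on the COMPUTATIONAL certificate `SahiGrid3.sStar_nonneg_of_isUpperSet` (`…SahiGridThreeCheck{,B,Two}`,
`native_decide`), everything else kernel-checked with standard axioms.

THEOREM (`latticeE3_gridProd_three_nonneg`).  For every `K`, every family of nonnegative chain weights `g : Fin 3 → Fin (K+1) → ℝ`
(product weight `w(ω) = ∏_a g a (ω a)` on the grid `[K+1]³ = Fin 3 → Fin (K+1)`, NOT normalised) and all up-sets `A, B, C`: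
`0 ≤ latticeE3 w A B C = Z³·E₃(A,B,C)`.  PROOF (tri-coefficient positivity + localisation):
(1) three-copy expansion `latticeE3 w A B C = Σ_{ω ∈ X³} (∏_c w(ω_c))·h(ω₀,ω₁,ω₂)` (`latticeE3_eq_sum_copies`);
(2) re-index the three copies' coordinates axis by axis: for `π ∈ S₃³`, `(T_π ω)_c(a) = ω_{π_a c}(a)` preserves the weight, so
    `216·latticeE3 = Σ_ω (∏ w)·S(ω)`, `S(ω) = Σ_π h(T_π ω)` (`latticeE3_symm`);
(3) `S(ω) = sStar (pb ω A) (pb ω B) (pb ω C)` for the pulled-back subsets of the small cube `Fin 3 → Fin 3` (`S_eq_sStar`);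
(4) sorting each axis (`Tuple.sort`) does not change `S` and makes the pull-backs up-sets (`S_sort`, `isUpperSet_pb`);
(5) the certificate: `sStar ≥ 0` on up-set triples of the small cube.
COROLLARIES: `liebSahi_grid_three_three` = layer `P(3,3)`; `uniformGrid_three_three` = `U(3,3)` (uniform boxes `[M]³`);
`fkg_grid_three_three` = `W(3,3)`: EVERY FKG probability weight on every `[a]×[b]×[c]`-type grid is Sahi-positive of order 3;
`sahiPositive_three_of_latticeEmbedding_grid3`: every FKG weight on every finite distributive lattice with a lattice embedding into a
3-D grid (J-width ≤ 3; e.g. `[2]²×[3]`, the two-layer lattices, `V+pt`, `Λ+pt`); `liebSahiContinuum_three_three`: Lieb–Sahi's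
Conjecture 1.1 on `[0,1]³` at order 3 (Lebesgue measure, monotone functions); the phase diagram now proved on `{d ≤ 3, n ≤ 3}`
(`uniformGrid_of_dim_le_three_three`).  Not covered: width 4 (e.g. `2⁴`) and orders `n ≥ 4` in dimension 3. [this work]
-/

namespace Summit.CriticalPhenomena.PercolationContinuityZ3.Theorems.SahiGrid3

open Finset Literature.Probability.LatticeModels Literature.Combinatorics.Sahi2008
open scoped BigOperators

noncomputable section

/-! ### (1) The three-copy expansion of `latticeE3` -/

section ThreeCopy

variable {Y : Type*} [Fintype Y] [DecidableEq Y]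

/-- Real indicator of a finset. [this work] -/
def indR (S : Finset Y) (y : Y) : ℝ := if y ∈ S then 1 else 0

omit [Fintype Y] in
/-- The real indicator is the cast of the integer one. [this work] -/
theorem indR_eq_cast (S : Finset Y) (y : Y) : indR S y = (ind S y : ℝ) := by
  unfold indR ind; split_ifs <;> simp

omit [Fintype Y] in
/-- Indicator of an intersection. [this work] -/
theorem indR_inter (A B : Finset Y) (y : Y) : indR (A ∩ B) y = indR A y * indR B y := by
  unfold indR
  by_cases hA : y ∈ A <;> by_cases hB : y ∈ B <;> simp [hA, hB, Finset.mem_inter]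

/-- Masses as indicator sums. [this work] -/
theorem mass_eq_sum_indR (w : Y → ℝ) (S : Finset Y) : mass w S = ∑ y, w y * indR S y :=
  (sum_mul_indicator_eq_mass w S).symm

omit [DecidableEq Y] in
/-- Factorisation of a separable sum over three copies. [this work] -/
theorem sum_copies_factor (w f g k : Y → ℝ) :
    ∑ ω : Fin 3 → Y, (∏ c, w (ω c)) * (f (ω 0) * g (ω 1) * k (ω 2)) =
      (∑ y, w y * f y) * (∑ y, w y * g y) * (∑ y, w y * k y) := by
  have h : ∀ ω : Fin 3 → Y, (∏ c, w (ω c)) * (f (ω 0) * g (ω 1) * k (ω 2)) =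
      ∏ c, (![fun y => w y * f y, fun y => w y * g y, fun y => w y * k y] : Fin 3 → Y → ℝ) c (ω c) := by
    intro ω
    rw [Fin.prod_univ_three, Fin.prod_univ_three]
    simp only [Matrix.cons_val_zero, Matrix.cons_val_one, Matrix.cons_val_two, Matrix.head_cons, Matrix.tail_cons]
    ring
  simp_rw [h]
  rw [← Fintype.prod_sum, Fin.prod_univ_three]
  simp only [Matrix.cons_val_zero, Matrix.cons_val_one, Matrix.cons_val_two, Matrix.head_cons, Matrix.tail_cons]

/-- Indicator of `univ`. [this work] -/
theorem indR_univ (y : Y) : indR (univ : Finset Y) y = 1 := by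
  unfold indR; simp

/-- **Three-copy expansion**: `latticeE3 w A B C = Σ_{ω ∈ Y³} (∏_c w(ω_c)) · h_{ABC}(ω₀, ω₁, ω₂)`. [this work] -/
theorem latticeE3_eq_sum_copies (w : Y → ℝ) (A B C : Finset Y) :
    latticeE3 w A B C = ∑ ω : Fin 3 → Y, (∏ c, w (ω c)) * (hZ A B C (ω 0) (ω 1) (ω 2) : ℝ) := by
  have hcast : ∀ ω : Fin 3 → Y, (∏ c, w (ω c)) * (hZ A B C (ω 0) (ω 1) (ω 2) : ℝ) =
      2 * ((∏ c, w (ω c)) * ((fun y => indR A y * indR B y * indR C y) (ω 0) * (fun _ => (1 : ℝ)) (ω 1) *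
        (fun _ => (1 : ℝ)) (ω 2)))
      - (∏ c, w (ω c)) * (indR A (ω 0) * (fun y => indR B y * indR C y) (ω 1) * (fun _ => (1 : ℝ)) (ω 2))
      - (∏ c, w (ω c)) * (indR B (ω 0) * (fun y => indR A y * indR C y) (ω 1) * (fun _ => (1 : ℝ)) (ω 2))
      - (∏ c, w (ω c)) * (indR C (ω 0) * (fun y => indR A y * indR B y) (ω 1) * (fun _ => (1 : ℝ)) (ω 2))
      + (∏ c, w (ω c)) * (indR A (ω 0) * indR B (ω 1) * indR C (ω 2)) := by
    intro ω
    unfold hZ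
    push_cast
    simp only [indR_eq_cast]
    ring
  rw [Finset.sum_congr rfl fun ω _ => hcast ω]
  simp only [Finset.sum_add_distrib, Finset.sum_sub_distrib, ← Finset.mul_sum]
  rw [sum_copies_factor w (fun y => indR A y * indR B y * indR C y) (fun _ => (1 : ℝ)) (fun _ => (1 : ℝ)),
    sum_copies_factor w (indR A) (fun y => indR B y * indR C y) (fun _ => (1 : ℝ)),
    sum_copies_factor w (indR B) (fun y => indR A y * indR C y) (fun _ => (1 : ℝ)),
    sum_copies_factor w (indR C) (fun y => indR A y * indR B y) (fun _ => (1 : ℝ)),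
    sum_copies_factor w (indR A) (indR B) (indR C)]
  unfold latticeE3
  simp only [mass_eq_sum_indR, indR_inter, indR_univ]
  ring

end ThreeCopy

/-! ### (2) Re-indexing the copies axis by axis -/

section Symm

variable {K : ℕ}

/-- The grid `[K+1]³`. [this work] -/
abbrev X3 (K : ℕ) := Fin 3 → Fin (K + 1)

/-- Re-indexing the three copies separately in each axis: `(T_π ω)_c(a) = ω_{π_a c}(a)`. [this work] -/
def Tmap (π : Fin 3 → Equiv.Perm (Fin 3)) (ω : Fin 3 → X3 K) : Fin 3 → X3 K := fun c a => ω (π a c) a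

/-- `T_π` as an equivalence. [this work] -/
def Tequiv (π : Fin 3 → Equiv.Perm (Fin 3)) : (Fin 3 → X3 K) ≃ (Fin 3 → X3 K) where
  toFun := Tmap π
  invFun := fun ω c a => ω ((π a).symm c) a
  left_inv := fun ω => by funext c a; simp [Tmap]
  right_inv := fun ω => by funext c a; simp [Tmap]

/-- The product weight is invariant under re-indexing. [this work] -/
theorem weight_Tmap (g : Fin 3 → Fin (K + 1) → ℝ) (π : Fin 3 → Equiv.Perm (Fin 3)) (ω : Fin 3 → X3 K) :
    (∏ c, ∏ a, g a (Tmap π ω c a)) = ∏ c, ∏ a, g a (ω c a) := by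
  calc (∏ c, ∏ a, g a (Tmap π ω c a)) = ∏ a, ∏ c, g a (ω (π a c) a) := Finset.prod_comm
    _ = ∏ a, ∏ c, g a (ω c a) := Finset.prod_congr rfl fun a _ => Equiv.prod_comp (π a) (fun c => g a (ω c a))
    _ = ∏ c, ∏ a, g a (ω c a) := Finset.prod_comm

/-- The symmetrised kernel `S(ω) = Σ_π h(T_π ω)`. [this work] -/
def Ssym (A B C : Finset (X3 K)) (ω : Fin 3 → X3 K) : ℤ :=
  ∑ π : Fin 3 → Equiv.Perm (Fin 3), hZ A B C (Tmap π ω 0) (Tmap π ω 1) (Tmap π ω 2)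

/-- **Symmetrisation**: `216 · latticeE3 = Σ_ω (∏ w) · S(ω)`. [this work] -/
theorem latticeE3_symm (g : Fin 3 → Fin (K + 1) → ℝ) (A B C : Finset (X3 K)) :
    (Fintype.card (Fin 3 → Equiv.Perm (Fin 3)) : ℝ) * latticeE3 (fun ω : X3 K => ∏ a, g a (ω a)) A B C =
      ∑ ω : Fin 3 → X3 K, (∏ c, ∏ a, g a (ω c a)) * (Ssym A B C ω : ℝ) := by
  have hπ : ∀ π : Fin 3 → Equiv.Perm (Fin 3), latticeE3 (fun ω : X3 K => ∏ a, g a (ω a)) A B C =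
      ∑ ω : Fin 3 → X3 K, (∏ c, ∏ a, g a (ω c a)) * (hZ A B C (Tmap π ω 0) (Tmap π ω 1) (Tmap π ω 2) : ℝ) := by
    intro π
    rw [latticeE3_eq_sum_copies, ← Equiv.sum_comp (Tequiv π)]
    refine Finset.sum_congr rfl fun ω _ => ?_
    show (∏ c, ∏ a, g a (Tmap π ω c a)) * _ = _
    rw [weight_Tmap]
    rfl
  rw [← nsmul_eq_mul, ← Finset.card_univ, ← Finset.sum_const, Finset.sum_congr rfl fun π _ => hπ π, Finset.sum_comm]
  refine Finset.sum_congr rfl fun ω _ => ?_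
  rw [← Finset.mul_sum]
  unfold Ssym
  push_cast
  rfl

/-! ### (3) The symmetrised kernel is `sStar` of the pulled-back triple -/

/-- Pull-back of a finset of the grid to the small cube along `ω`: `q ↦ (a ↦ ω_{q a}(a))`. [this work] -/
def pb (ω : Fin 3 → X3 K) (A : Finset (X3 K)) : Finset P3 := univ.filter fun q => (fun a => ω (q a) a) ∈ A

/-- Indicators under pull-back. [this work] -/
theorem ind_Tmap (A : Finset (X3 K)) (ω : Fin 3 → X3 K) (π : Fin 3 → Equiv.Perm (Fin 3)) (c : Fin 3) :
    ind A (Tmap π ω c) = ind (pb ω A) (fun a => π a c) := by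
  unfold ind pb Tmap
  simp only [mem_filter, mem_univ, true_and]

/-- The pattern re-parametrisation `π ↦ (β, γ, ρ) = (π₁ ∘ π₀⁻¹, π₂ ∘ π₀⁻¹, π₀)`. [this work] -/
def patEquiv : (Fin 3 → Equiv.Perm (Fin 3)) ≃ Equiv.Perm (Fin 3) × Equiv.Perm (Fin 3) × Equiv.Perm (Fin 3) where
  toFun π := ((π 0).symm.trans (π 1), (π 0).symm.trans (π 2), π 0)
  invFun t := ![t.2.2, t.2.2.trans t.1, t.2.2.trans t.2.1]
  left_inv π := by
    funext a
    fin_cases a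
    · rfl
    · ext x; simp
    · ext x; simp
  right_inv t := by
    obtain ⟨β, γ, ρ⟩ := t
    refine Prod.ext ?_ (Prod.ext ?_ ?_)
    · ext x; simp
    · ext x; simp
    · rfl

/-- Columns of `π` are pattern points: `(a ↦ π a c) = P_{ρ c}` with `(β, γ, ρ) = patEquiv π`. [this work] -/
theorem col_eq_pt (π : Fin 3 → Equiv.Perm (Fin 3)) (c : Fin 3) :
    (fun a => π a c) = pt ((patEquiv π).1) ((patEquiv π).2.1) ((patEquiv π).2.2 c) := by
  funext a
  fin_cases a
  · rfl
  · simp [pt, patEquiv]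
  · simp [pt, patEquiv]

/-- **`S(ω) = sStar (pb ω A) (pb ω B) (pb ω C)`.** [this work] -/
theorem S_eq_sStar (A B C : Finset (X3 K)) (ω : Fin 3 → X3 K) : Ssym A B C ω = sStar (pb ω A) (pb ω B) (pb ω C) := by
  unfold Ssym sStar
  have h : ∀ π : Fin 3 → Equiv.Perm (Fin 3), hZ A B C (Tmap π ω 0) (Tmap π ω 1) (Tmap π ω 2) =
      hZ (pb ω A) (pb ω B) (pb ω C) (pt ((patEquiv π).1) ((patEquiv π).2.1) ((patEquiv π).2.2 0))
        (pt ((patEquiv π).1) ((patEquiv π).2.1) ((patEquiv π).2.2 1))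
        (pt ((patEquiv π).1) ((patEquiv π).2.1) ((patEquiv π).2.2 2)) := by
    intro π
    unfold hZ
    simp only [ind_Tmap, col_eq_pt]
  simp_rw [h]
  rw [Fintype.sum_equiv patEquiv _ (fun t => hZ (pb ω A) (pb ω B) (pb ω C) (pt t.1 t.2.1 (t.2.2 0))
    (pt t.1 t.2.1 (t.2.2 1)) (pt t.1 t.2.1 (t.2.2 2))) (fun π => rfl), Fintype.sum_prod_type]
  refine Finset.sum_congr rfl fun β _ => ?_
  rw [Fintype.sum_prod_type]

/-! ### (4) Sorting the copies -/

/-- Composing with fixed permutations axis by axis does not change `S`. [this work] -/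
theorem S_Tmap (A B C : Finset (X3 K)) (σ : Fin 3 → Equiv.Perm (Fin 3)) (ω : Fin 3 → X3 K) :
    Ssym A B C (Tmap σ ω) = Ssym A B C ω := by
  unfold Ssym
  have h : ∀ π : Fin 3 → Equiv.Perm (Fin 3), Tmap π (Tmap σ ω) = Tmap (fun a => (π a).trans (σ a)) ω := by
    intro π; funext c a; rfl
  simp_rw [h]
  exact Fintype.sum_equiv (Equiv.piCongrRight fun a => Equiv.mulLeft (σ a)) _ _ fun π => rfl

/-- A sorted `ω` (each axis' coordinates nondecreasing along the copies) pulls up-sets back to up-sets. [this work] -/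
theorem isUpperSet_pb {ω : Fin 3 → X3 K} (hω : ∀ a, Monotone fun c => ω c a) {A : Finset (X3 K)}
    (hA : IsUpperSet (A : Set (X3 K))) : IsUpperSet (pb ω A : Set P3) := by
  intro q q' hqq' hq
  rw [Finset.mem_coe] at hq ⊢
  unfold pb at hq ⊢
  rw [mem_filter] at hq ⊢
  exact ⟨mem_univ _, hA (fun a => hω a (hqq' a)) hq.2⟩

/-- **`S(ω) ≥ 0`** for up-sets `A, B, C` of the grid: sort, pull back, apply the certificate. [this work] -/
theorem Ssym_nonneg {A B C : Finset (X3 K)} (hA : IsUpperSet (A : Set (X3 K))) (hB : IsUpperSet (B : Set (X3 K)))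
    (hC : IsUpperSet (C : Set (X3 K))) (ω : Fin 3 → X3 K) : 0 ≤ Ssym A B C ω := by
  -- sorting permutations, one per axis
  let σ : Fin 3 → Equiv.Perm (Fin 3) := fun a => Tuple.sort fun c => ω c a
  have hsort : ∀ a, Monotone fun c => Tmap σ ω c a := fun a => by
    show Monotone ((fun c => ω c a) ∘ σ a)
    exact Tuple.monotone_sort _
  rw [← S_Tmap A B C σ ω, S_eq_sStar]
  exact sStar_nonneg_of_isUpperSet (isUpperSet_pb hsort hA) (isUpperSet_pb hsort hB) (isUpperSet_pb hsort hC)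

/-! ### (5) The theorem -/

/-- **Sahi's `C₃` on the three-dimensional grid, homogeneous form**: for every nonnegative product weight on `[K+1]³` and all
up-sets `A, B, C`, `0 ≤ latticeE3 w A B C` (`= Z³·E₃(A,B,C)`). [this work] -/
theorem latticeE3_gridProd_three_nonneg (g : Fin 3 → Fin (K + 1) → ℝ) (hg : ∀ a u, 0 ≤ g a u) {A B C : Finset (X3 K)}
    (hA : IsUpperSet (A : Set (X3 K))) (hB : IsUpperSet (B : Set (X3 K))) (hC : IsUpperSet (C : Set (X3 K))) :
    0 ≤ latticeE3 (fun ω : X3 K => ∏ a, g a (ω a)) A B C := by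
  have hcard : (0 : ℝ) < Fintype.card (Fin 3 → Equiv.Perm (Fin 3)) := by exact_mod_cast Fintype.card_pos
  have h := latticeE3_symm g A B C
  have hsum : 0 ≤ ∑ ω : Fin 3 → X3 K, (∏ c, ∏ a, g a (ω c a)) * (Ssym A B C ω : ℝ) :=
    Finset.sum_nonneg fun ω _ => mul_nonneg (Finset.prod_nonneg fun c _ => Finset.prod_nonneg fun a _ => hg a _)
      (by exact_mod_cast Ssym_nonneg hA hB hC ω)
  rw [← h] at hsum
  exact (mul_nonneg_iff_of_pos_left hcard).1 hsum

end Symm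

/-! ### Corollaries: the cell `(3,3)` of the width stratification -/

section Corollaries

/-- **Layer `P(3,3)`: every product probability weight on every three-dimensional grid `[K+1]³` is Sahi-positive of order 3**
(Lieb–Sahi's Conjecture 1.1 for `[0,1]³` at order 3, discrete product form). [this work] -/
theorem liebSahi_grid_three_three :
    ∀ (K : ℕ) (g : Fin 3 → Fin (K + 1) → ℝ), (∀ i u, 0 ≤ g i u) → (∀ i, ∑ u, g i u = 1) →
      SahiPositive (fun ω : Fin 3 → Fin (K + 1) => ∏ i, g i (ω i)) 3 := by
  classical
  intro K g hg0 hg1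
  rw [sahiPositive_iff_indicators]
  intro Uf hU
  have hsum : ∑ ω : Fin 3 → Fin (K + 1), ∏ i, g i (ω i) = 1 := by
    rw [← Fintype.prod_sum]; simp [hg1]
  have hf : (fun i => setInd (Uf i)) = ![setInd (Uf 0), setInd (Uf 1), setInd (Uf 2)] := by
    funext i; fin_cases i <;> rfl
  rw [hf, sahiE_three_indicator_eq_latticeE3 hsum]
  exact latticeE3_gridProd_three_nonneg g hg0 (hU 0) (hU 1) (hU 2)

/-- **Layer `U(3,3)`: the uniform weight on every box `[M]³` is Sahi-positive of order 3** — three monotone nonnegative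
functions on the uniform discrete cube satisfy `E₃ ≥ 0`. [this work] -/
theorem uniformGrid_three_three : ∀ M, 0 < M → SahiPositive (fun _ : Fin 3 → Fin M => (1 : ℝ) / (M : ℝ) ^ 3) 3 :=
  (SahiWidth.liebSahi_grid_iff_uniform 3 3).1 liebSahi_grid_three_three

/-- **Layer `W(3,3)`: EVERY FKG probability weight on every three-dimensional grid is Sahi-positive of order 3** — Sahi's
Conjecture 5 at `n = 3` for all log-supermodular weights on `[b+1]³`. [this work] -/
theorem fkg_grid_three_three : ∀ (b : ℕ) (μ : (Fin 3 → Fin (b + 1)) → ℝ), IsFKGMeasure μ → SahiPositive μ 3 :=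
  (SahiWidth.liebSahi_grid_iff_fkg_grid 3 3).1 liebSahi_grid_three_three

/-- **Every FKG weight on every lattice of J-width ≤ 3**: if a finite distributive lattice `L` has a lattice embedding into a
three-dimensional grid, every FKG probability weight on `L` is Sahi-positive of order 3 (this covers `[2]²×[3]`, the two-layer
lattices `[2]×[b+1]²`, `V+pt`, `Λ+pt`, `2³⊕2³`, …). [this work] -/
theorem sahiPositive_three_of_latticeEmbedding_grid3 {L : Type*} [DistribLattice L] [Fintype L] [DecidableEq L] {b : ℕ}
    (e : L → (Fin 3 → Fin (b + 1))) (he : Function.Injective e) (hinf : ∀ x y, e (x ⊓ y) = e x ⊓ e y)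
    (hsup : ∀ x y, e (x ⊔ y) = e x ⊔ e y) {μ : L → ℝ} (hμ : IsFKGMeasure μ) : SahiPositive μ 3 :=
  SahiWidth.sahiPositive_of_latticeEmbedding_grid liebSahi_grid_three_three e he hinf hsup hμ

/-- **Lieb–Sahi's Conjecture 1.1 in dimension 3 at order 3**: Lebesgue measure on `[0,1]³` is Sahi-positive of order 3
(`E₃(f,g,h) ≥ 0` for nonnegative monotone `f, g, h` on the unit cube). [this work] -/
theorem liebSahiContinuum_three_three : LiebSahiContinuum 3 3 :=
  (liebSahiContinuum_iff_uniformGrid 3 3).2 uniformGrid_three_three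

/-- **The phase diagram, updated**: `U(d,3)` for every `d ≤ 3` (with `SahiWidth.uniformGrid_of_dim_le_two_or_order_le_two`
the proved region is now `{d ≤ 2} ∪ {n ≤ 2} ∪ {d ≤ 3, n ≤ 3}`; first open cells `(4,3)` and `(3,4)`). [this work] -/
theorem uniformGrid_of_dim_le_three_three {d : ℕ} (hd : d ≤ 3) :
    ∀ M, 0 < M → SahiPositive (fun _ : Fin d → Fin M => (1 : ℝ) / (M : ℝ) ^ d) 3 := by
  have h3 := uniformGrid_three_three
  have h2 : ∀ M, 0 < M → SahiPositive (fun _ : Fin 2 → Fin M => (1 : ℝ) / (M : ℝ) ^ 2) 3 :=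
    SahiWidth.uniformGrid_anti_dim (d := 2) h3
  have h1 : ∀ M, 0 < M → SahiPositive (fun _ : Fin 1 → Fin M => (1 : ℝ) / (M : ℝ) ^ 1) 3 :=
    SahiWidth.uniformGrid_anti_dim (d := 1) h2
  have h0 : ∀ M, 0 < M → SahiPositive (fun _ : Fin 0 → Fin M => (1 : ℝ) / (M : ℝ) ^ 0) 3 :=
    SahiWidth.uniformGrid_anti_dim (d := 0) h1
  interval_cases d
  · exact h0
  · exact h1
  · exact h2
  · exact h3

/-- **Lieb–Sahi's conjecture in every dimension `d ≤ 3` at order 3.** [this work] -/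
theorem liebSahiContinuum_of_dim_le_three_three {d : ℕ} (hd : d ≤ 3) : LiebSahiContinuum d 3 :=
  (liebSahiContinuum_iff_uniformGrid d 3).2 (uniformGrid_of_dim_le_three_three hd)

end Corollaries

end

end Summit.CriticalPhenomena.PercolationContinuityZ3.Theorems.SahiGrid3
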